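import Summits.CriticalPhenomena.PercolationContinuityZ3.Theorems.PercNearOneGluingNoHeavyLowerTailSwitchRelaxK4R58A
import Summits.CriticalPhenomena.PercolationContinuityZ3.Theorems.PercNearOneGluingNoHeavyLowerTailSwitchRelaxK4R58B
import Summits.CriticalPhenomena.PercolationContinuityZ3.Theorems.PercNearOneGluingNoHeavyLowerTailSwitchRelaxK4R58C
import Summits.CriticalPhenomena.PercolationContinuityZ3.Theorems.PercNearOneGluingNoHeavyLowerTailSwitchRelaxK4R58D
import Summits.CriticalPhenomena.PercolationContinuityZ3.Theorems.PercNearOneGluingNoHeavyLowerTailSwitchRelaxK4R58E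
import Summits.CriticalPhenomena.PercolationContinuityZ3.Theorems.PercNearOneGluingNoHeavyLowerTailSwitchRelaxK4R58F
import Summits.CriticalPhenomena.PercolationContinuityZ3.Theorems.PercNearOneGluingNoHeavyLowerTailSwitchRelaxK4R58G
import Summits.CriticalPhenomena.PercolationContinuityZ3.Theorems.PercNearOneGluingNoHeavyLowerTailSwitchRelaxK4R58H
import Summits.CriticalPhenomena.PercolationContinuityZ3.Theorems.PercNearOneGluingNoHeavyLowerTailSwitchRelaxK4R58I
import Summits.CriticalPhenomena.PercolationContinuityZ3.Theorems.PercNearOneGluingNoHeavyLowerTailSwitchRelaxK4R58J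
import Summits.CriticalPhenomena.PercolationContinuityZ3.Theorems.PercNearOneGluingNoHeavyLowerTailSwitchRelaxK4R58K
import Summits.CriticalPhenomena.PercolationContinuityZ3.Theorems.PercNearOneGluingNoHeavyLowerTailSwitchRelaxK4R58L
import Summits.CriticalPhenomena.PercolationContinuityZ3.Theorems.PercNearOneGluingNoHeavyLowerTailSwitchRelaxK4R58M1
import Summits.CriticalPhenomena.PercolationContinuityZ3.Theorems.PercNearOneGluingNoHeavyLowerTailSwitchRelaxK4R58M2
import Summits.CriticalPhenomena.PercolationContinuityZ3.Theorems.PercNearOneGluingNoHeavyLowerTailSwitchRelaxQuarticFamily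
import Summits.CriticalPhenomena.PercolationContinuityZ3.Theorems.PercNearOneGluingNoHeavyLowerTailSwitchRelaxIncDictionary
import Literature.Probability.LatticeModels.SahiFourthOrderCorrelation
import Mathlib.Tactic.Linarith
import HarnessLib

/-!
# `NoHeavyLowerTail` (stmt-CriticalPhenomena-4575) — THEOREM on EVERY finite weighted graph: the generic increasing QUARTIC row
# `0 ≤ E₄(U[a|bc], U[a|by], U[ac|b], U[ay|b])` on four points (Sahi `C₄` instance), from the spectator-sliced four-copy switching certificate `r58inc`

Support file (prover prim-masterthm-p1 gen 3; `--supports stmt-CriticalPhenomena-4575`).  No named facts, no sorries.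

This row is one of prim-injmine-2's 31 GENERIC (tower-IRREDUCIBLE: no identity `row = Σ nonneg multiplier × lower Sahi/Harris rows` of
any degree) increasing quartic letter rows on four marked points — the layer above the cubic FRONTIER-4PT; it was certified by
prim-masterthm-p1 gen 2 with a ONE-STEP four-copy switching certificate Σ₂(4,4) (one spectator copy).  By SPECTATOR SLICING
(SCHEMA-K §10.3) that certificate is fifteen three-copy certificates `S00.cert … S14.cert` (data files `…SwitchRelaxK4R58A…`,
each kernel-checked ⇒ `E[S_q] = ES _ P ≤ 0`) plus the quartic identity `Σ_q P_q·(λ₀^q + σ·Σλ^q) + 16·E₄ʰᵒᵐ ≡ 0`, checked here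
coefficientwise by the kernel (`chk_q : quarticCheckAt … = true`, part III c `…SwitchRelaxQuartic`); `quartic_sound` + the
dictionary "event = sum of four-point cells" give `sahiE4_nonneg`.  One of the kernel theorems of Sahi-`C₄`-level generic rows at NT = 4 (the first was `…SwitchRelaxK4R11Measure`).
-/

noncomputable section

namespace Summit.CriticalPhenomena.PercolationContinuityZ3.Theorems

namespace SwitchRelax

namespace K4R58

open Finset MeasureTheory Set Literature.Probability.Percolation Literature.Probability.LatticeModels FourPointAtoms
open Summit.CriticalPhenomena.PercolationContinuityZ3.Cruxes.AdditiveGluing.TieLine.ConnAtoms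
open scoped Classical BigOperators

/-! ### The fifteen slices as one family; tables; the quartic identity (kernel) -/

/-- The slice certificates as a list, indexed by the spectator type in `FourPointAtoms.pat4` order (position `p` holds the
data-file slice `Sτ` with `[14,13,12,11,10,9,8,7,6,5,3,4,2,1,0][τ] = p`: the data files number the slices by the certificate's own
type order τ — prim-masterthm-p1's `types` list, RGS order — and their docstrings' phrase "spectator type τ of pat4" is to be read
through this dictionary). [this work] -/
def certsL : List Cert :=
  [S14.cert, S13.cert, S12.cert, S10.cert, S11.cert, S09.cert, S08.cert, S07.cert, S06.cert, S05.cert, S04.cert, S03.cert, S02.cert, S01.cert, S00.cert]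

/-- The slices' tabulated input potentials (aligned with `certsL`). [this work] -/
def T0s : List (List (List (List ℤ))) :=
  [S14.T03, S13.T03, S12.T03, S10.T03, S11.T03, S09.T03, S08.T03, S07.T03, S06.T03, S05.T03, S04.T03, S03.T03, S02.T03, S01.T03, S00.T03]

/-- The slices' tabulated program potentials (aligned with `certsL`). [this work] -/
def TPs : List (List (List (List ℤ))) :=
  [S14.TPb, S13.TPb, S12.TPb, S10.TPb, S11.TPb, S09.TPb, S08.TPb, S07.TPb, S06.TPb, S05.TPb, S04.TPb, S03.TPb, S02.TPb, S01.TPb, S00.TPb]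

/-- The cell lists of the four events `U[a|bc], U[a|by], U[ac|b], U[ay|b]` and of their intersections (`FourPointAtoms` cell order). [this work] -/
def E4L : E4Lists :=
  ⟨[5, 6, 9, 10, 11, 12, 13, 14], [4, 6, 8, 10, 11, 12, 13, 14], [3, 6, 7, 8, 11, 12, 13, 14], [2, 6, 7, 9, 11, 12, 13, 14], [6, 10, 11, 12, 13, 14], [6, 11, 12, 13, 14], [6, 9, 11, 12, 13, 14], [6, 8, 11, 12, 13, 14], [6, 11, 12, 13, 14], [6, 7, 11, 12, 13, 14], [6, 11, 12, 13, 14], [6, 11, 12, 13, 14], [6, 11, 12, 13, 14], [6, 11, 12, 13, 14], [6, 11, 12, 13, 14]⟩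

/-- Scalar part of the quartic check (`D = 16 > 0`, admissible cell lists; kernel). [this work] -/
theorem chk0 : quarticCheck0 16 K4R58.E4L = true := by decide +kernel

/-- The quartic identity, piece `0` (sorted index quadruples with smallest entry `0`; kernel). [this work] -/
theorem chk_0 : quarticCheckAt K4R58.T0s K4R58.TPs 16 K4R58.E4L 0 = true := by decide +kernel

/-- The quartic identity, piece `1` (sorted index quadruples with smallest entry `1`; kernel). [this work] -/
theorem chk_1 : quarticCheckAt K4R58.T0s K4R58.TPs 16 K4R58.E4L 1 = true := by decide +kernel

/-- The quartic identity, piece `2` (sorted index quadruples with smallest entry `2`; kernel). [this work] -/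
theorem chk_2 : quarticCheckAt K4R58.T0s K4R58.TPs 16 K4R58.E4L 2 = true := by decide +kernel

/-- The quartic identity, piece `3` (sorted index quadruples with smallest entry `3`; kernel). [this work] -/
theorem chk_3 : quarticCheckAt K4R58.T0s K4R58.TPs 16 K4R58.E4L 3 = true := by decide +kernel

/-- The quartic identity, piece `4` (sorted index quadruples with smallest entry `4`; kernel). [this work] -/
theorem chk_4 : quarticCheckAt K4R58.T0s K4R58.TPs 16 K4R58.E4L 4 = true := by decide +kernel

/-- The quartic identity, piece `5` (sorted index quadruples with smallest entry `5`; kernel). [this work] -/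
theorem chk_5 : quarticCheckAt K4R58.T0s K4R58.TPs 16 K4R58.E4L 5 = true := by decide +kernel

/-- The quartic identity, piece `6` (sorted index quadruples with smallest entry `6`; kernel). [this work] -/
theorem chk_6 : quarticCheckAt K4R58.T0s K4R58.TPs 16 K4R58.E4L 6 = true := by decide +kernel

/-- The quartic identity, piece `7` (sorted index quadruples with smallest entry `7`; kernel). [this work] -/
theorem chk_7 : quarticCheckAt K4R58.T0s K4R58.TPs 16 K4R58.E4L 7 = true := by decide +kernel

/-- The quartic identity, piece `8` (sorted index quadruples with smallest entry `8`; kernel). [this work] -/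
theorem chk_8 : quarticCheckAt K4R58.T0s K4R58.TPs 16 K4R58.E4L 8 = true := by decide +kernel

/-- The quartic identity, piece `9` (sorted index quadruples with smallest entry `9`; kernel). [this work] -/
theorem chk_9 : quarticCheckAt K4R58.T0s K4R58.TPs 16 K4R58.E4L 9 = true := by decide +kernel

/-- The quartic identity, piece `10` (sorted index quadruples with smallest entry `10`; kernel). [this work] -/
theorem chk_10 : quarticCheckAt K4R58.T0s K4R58.TPs 16 K4R58.E4L 10 = true := by decide +kernel

/-- The quartic identity, piece `11` (sorted index quadruples with smallest entry `11`; kernel). [this work] -/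
theorem chk_11 : quarticCheckAt K4R58.T0s K4R58.TPs 16 K4R58.E4L 11 = true := by decide +kernel

/-- The quartic identity, piece `12` (sorted index quadruples with smallest entry `12`; kernel). [this work] -/
theorem chk_12 : quarticCheckAt K4R58.T0s K4R58.TPs 16 K4R58.E4L 12 = true := by decide +kernel

/-- The quartic identity, piece `13` (sorted index quadruples with smallest entry `13`; kernel). [this work] -/
theorem chk_13 : quarticCheckAt K4R58.T0s K4R58.TPs 16 K4R58.E4L 13 = true := by decide +kernel

/-- The quartic identity, piece `14` (sorted index quadruples with smallest entry `14`; kernel). [this work] -/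
theorem chk_14 : quarticCheckAt K4R58.T0s K4R58.TPs 16 K4R58.E4L 14 = true := by decide +kernel

/-- All fifteen pieces of the quartic identity. [this work] -/
theorem chk_all : ∀ q₀ : Ty, quarticCheckAt K4R58.T0s K4R58.TPs 16 K4R58.E4L q₀ = true := by
  intro q; fin_cases q
  exacts [chk_0, chk_1, chk_2, chk_3, chk_4, chk_5, chk_6, chk_7, chk_8, chk_9, chk_10, chk_11, chk_12, chk_13, chk_14]

/-- The table hypothesis for the slices' input potentials (a `Forall₂` chain, no unfolding). [this work] -/
theorem hT0 : List.Forall₂ (fun c T => ∀ πX : Ty, TabOK (c.lam0 πX) (getN T πX.val [])) K4R58.certsL K4R58.T0s :=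
  List.Forall₂.cons (fun πX => tabOK_bucket3 S14.ents0 πX) <|
  List.Forall₂.cons (fun πX => tabOK_bucket3 S13.ents0 πX) <|
  List.Forall₂.cons (fun πX => tabOK_bucket3 S12.ents0 πX) <|
  List.Forall₂.cons (fun πX => tabOK_bucket3 S10.ents0 πX) <|
  List.Forall₂.cons (fun πX => tabOK_bucket3 S11.ents0 πX) <|
  List.Forall₂.cons (fun πX => tabOK_bucket3 S09.ents0 πX) <|
  List.Forall₂.cons (fun πX => tabOK_bucket3 S08.ents0 πX) <|
  List.Forall₂.cons (fun πX => tabOK_bucket3 S07.ents0 πX) <|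
  List.Forall₂.cons (fun πX => tabOK_bucket3 S06.ents0 πX) <|
  List.Forall₂.cons (fun πX => tabOK_bucket3 S05.ents0 πX) <|
  List.Forall₂.cons (fun πX => tabOK_bucket3 S04.ents0 πX) <|
  List.Forall₂.cons (fun πX => tabOK_bucket3 S03.ents0 πX) <|
  List.Forall₂.cons (fun πX => tabOK_bucket3 S02.ents0 πX) <|
  List.Forall₂.cons (fun πX => tabOK_bucket3 S01.ents0 πX) <|
  List.Forall₂.cons (fun πX => tabOK_bucket3 S00.ents0 πX) <|
  List.Forall₂.nil

/-- The table hypothesis for the slices' program potentials. [this work] -/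
theorem hTP : List.Forall₂ (fun c TP => List.Forall₂ (fun p T => TabOK p.lam T) c.progs TP) K4R58.certsL K4R58.TPs :=
  List.Forall₂.cons S14.TPb_ok <|
  List.Forall₂.cons S13.TPb_ok <|
  List.Forall₂.cons S12.TPb_ok <|
  List.Forall₂.cons S10.TPb_ok <|
  List.Forall₂.cons S11.TPb_ok <|
  List.Forall₂.cons S09.TPb_ok <|
  List.Forall₂.cons S08.TPb_ok <|
  List.Forall₂.cons S07.TPb_ok <|
  List.Forall₂.cons S06.TPb_ok <|
  List.Forall₂.cons S05.TPb_ok <|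
  List.Forall₂.cons S04.TPb_ok <|
  List.Forall₂.cons S03.TPb_ok <|
  List.Forall₂.cons S02.TPb_ok <|
  List.Forall₂.cons S01.TPb_ok <|
  List.Forall₂.cons S00.TPb_ok <|
  List.Forall₂.nil

/-- Fifteen slices. [this work] -/
theorem hlen : K4R58.certsL.length = 15 := rfl

/-! ### The dictionary and the theorem for `prodBernoulli w` -/

section Measure

variable {V : Type*} [Fintype V] (w : Sym2 V → unitInterval) (a b c y : V)

/-- Every slice has nonpositive expectation at the cell masses of `(w; a, b, c, y)`. [this work] -/
theorem hES : ∀ c' ∈ K4R58.certsL, ES c' (cell w a b c y) ≤ 0 := by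
  have hp0 : ∀ e, 0 ≤ (w e : ℝ) := fun e => (w e).2.1
  have hp1 : ∀ e, (w e : ℝ) ≤ 1 := fun e => (w e).2.2
  have e0 := ES_nonpos_of_Sreal (quad a b c y) S14.cert (S14.Sreal_nonpos (quad a b c y)) hp0 hp1 Finset.univ
  simp only [PrW_tyEv_eq_cell] at e0
  have e1 := ES_nonpos_of_Sreal (quad a b c y) S13.cert (S13.Sreal_nonpos (quad a b c y)) hp0 hp1 Finset.univ
  simp only [PrW_tyEv_eq_cell] at e1
  have e2 := ES_nonpos_of_Sreal (quad a b c y) S12.cert (S12.Sreal_nonpos (quad a b c y)) hp0 hp1 Finset.univ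
  simp only [PrW_tyEv_eq_cell] at e2
  have e3 := ES_nonpos_of_Sreal (quad a b c y) S10.cert (S10.Sreal_nonpos (quad a b c y)) hp0 hp1 Finset.univ
  simp only [PrW_tyEv_eq_cell] at e3
  have e4 := ES_nonpos_of_Sreal (quad a b c y) S11.cert (S11.Sreal_nonpos (quad a b c y)) hp0 hp1 Finset.univ
  simp only [PrW_tyEv_eq_cell] at e4
  have e5 := ES_nonpos_of_Sreal (quad a b c y) S09.cert (S09.Sreal_nonpos (quad a b c y)) hp0 hp1 Finset.univ
  simp only [PrW_tyEv_eq_cell] at e5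
  have e6 := ES_nonpos_of_Sreal (quad a b c y) S08.cert (S08.Sreal_nonpos (quad a b c y)) hp0 hp1 Finset.univ
  simp only [PrW_tyEv_eq_cell] at e6
  have e7 := ES_nonpos_of_Sreal (quad a b c y) S07.cert (S07.Sreal_nonpos (quad a b c y)) hp0 hp1 Finset.univ
  simp only [PrW_tyEv_eq_cell] at e7
  have e8 := ES_nonpos_of_Sreal (quad a b c y) S06.cert (S06.Sreal_nonpos (quad a b c y)) hp0 hp1 Finset.univ
  simp only [PrW_tyEv_eq_cell] at e8
  have e9 := ES_nonpos_of_Sreal (quad a b c y) S05.cert (S05.Sreal_nonpos (quad a b c y)) hp0 hp1 Finset.univ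
  simp only [PrW_tyEv_eq_cell] at e9
  have e10 := ES_nonpos_of_Sreal (quad a b c y) S04.cert (S04.Sreal_nonpos (quad a b c y)) hp0 hp1 Finset.univ
  simp only [PrW_tyEv_eq_cell] at e10
  have e11 := ES_nonpos_of_Sreal (quad a b c y) S03.cert (S03.Sreal_nonpos (quad a b c y)) hp0 hp1 Finset.univ
  simp only [PrW_tyEv_eq_cell] at e11
  have e12 := ES_nonpos_of_Sreal (quad a b c y) S02.cert (S02.Sreal_nonpos (quad a b c y)) hp0 hp1 Finset.univ
  simp only [PrW_tyEv_eq_cell] at e12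
  have e13 := ES_nonpos_of_Sreal (quad a b c y) S01.cert (S01.Sreal_nonpos (quad a b c y)) hp0 hp1 Finset.univ
  simp only [PrW_tyEv_eq_cell] at e13
  have e14 := ES_nonpos_of_Sreal (quad a b c y) S00.cert (S00.Sreal_nonpos (quad a b c y)) hp0 hp1 Finset.univ
  simp only [PrW_tyEv_eq_cell] at e14
  exact List.forall_mem_cons.2 ⟨e0, List.forall_mem_cons.2 ⟨e1, List.forall_mem_cons.2 ⟨e2, List.forall_mem_cons.2 ⟨e3, List.forall_mem_cons.2 ⟨e4, List.forall_mem_cons.2 ⟨e5, List.forall_mem_cons.2 ⟨e6, List.forall_mem_cons.2 ⟨e7, List.forall_mem_cons.2 ⟨e8, List.forall_mem_cons.2 ⟨e9, List.forall_mem_cons.2 ⟨e10, List.forall_mem_cons.2 ⟨e11, List.forall_mem_cons.2 ⟨e12, List.forall_mem_cons.2 ⟨e13, List.forall_mem_cons.2 ⟨e14, List.forall_mem_nil _⟩⟩⟩⟩⟩⟩⟩⟩⟩⟩⟩⟩⟩⟩⟩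

/-- Dictionary entry: the event `openConn a b ∪ openConn a c` as a sum of four-point cells. -/
theorem rE0 : (prodBernoulli w).real (openConn a b ∪ openConn a c) =
    cell w a b c y 5 + cell w a b c y 6 + cell w a b c y 9 + cell w a b c y 10 + cell w a b c y 11 + cell w a b c y 12 + cell w a b c y 13 + cell w a b c y 14 := by
  rw [measureReal_eq_cellSum w a b c y (show HasPattern (quad a b c y) (openConn a b ∪ openConn a c) _ from
    (((oc a b c y 0 1 rfl rfl)).union (oc a b c y 0 2 rfl rfl)))]
  simp (config := {decide := true}) only [ite_true, ite_false]; ring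

/-- Dictionary entry: the event `openConn a b ∪ openConn a y` as a sum of four-point cells. -/
theorem rE1 : (prodBernoulli w).real (openConn a b ∪ openConn a y) =
    cell w a b c y 4 + cell w a b c y 6 + cell w a b c y 8 + cell w a b c y 10 + cell w a b c y 11 + cell w a b c y 12 + cell w a b c y 13 + cell w a b c y 14 := by
  rw [measureReal_eq_cellSum w a b c y (show HasPattern (quad a b c y) (openConn a b ∪ openConn a y) _ from
    (((oc a b c y 0 1 rfl rfl)).union (oc a b c y 0 3 rfl rfl)))]
  simp (config := {decide := true}) only [ite_true, ite_false]; ring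

/-- Dictionary entry: the event `(openConn a b ∪ openConn a c) ∩ (openConn a b ∪ openConn a y)` as a sum of four-point cells. -/
theorem rE2 : (prodBernoulli w).real ((openConn a b ∪ openConn a c) ∩ (openConn a b ∪ openConn a y)) =
    cell w a b c y 6 + cell w a b c y 10 + cell w a b c y 11 + cell w a b c y 12 + cell w a b c y 13 + cell w a b c y 14 := by
  rw [measureReal_eq_cellSum w a b c y (show HasPattern (quad a b c y) ((openConn a b ∪ openConn a c) ∩ (openConn a b ∪ openConn a y)) _ from
    (((((oc a b c y 0 1 rfl rfl)).union (oc a b c y 0 2 rfl rfl))).inter (((oc a b c y 0 1 rfl rfl)).union (oc a b c y 0 3 rfl rfl))))]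
  simp (config := {decide := true}) only [ite_true, ite_false]; ring

/-- Dictionary entry: the event `(openConn a b ∪ openConn a c) ∩ (openConn a b ∪ openConn c b)` as a sum of four-point cells. -/
theorem rE3 : (prodBernoulli w).real ((openConn a b ∪ openConn a c) ∩ (openConn a b ∪ openConn c b)) =
    cell w a b c y 6 + cell w a b c y 11 + cell w a b c y 12 + cell w a b c y 13 + cell w a b c y 14 := by
  rw [measureReal_eq_cellSum w a b c y (show HasPattern (quad a b c y) ((openConn a b ∪ openConn a c) ∩ (openConn a b ∪ openConn c b)) _ from
    (((((oc a b c y 0 1 rfl rfl)).union (oc a b c y 0 2 rfl rfl))).inter (((oc a b c y 0 1 rfl rfl)).union (oc a b c y 2 1 rfl rfl))))]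
  simp (config := {decide := true}) only [ite_true, ite_false]; ring

/-- Dictionary entry: the event `(openConn a b ∪ openConn a c) ∩ (openConn a b ∪ openConn y b)` as a sum of four-point cells. -/
theorem rE4 : (prodBernoulli w).real ((openConn a b ∪ openConn a c) ∩ (openConn a b ∪ openConn y b)) =
    cell w a b c y 6 + cell w a b c y 9 + cell w a b c y 11 + cell w a b c y 12 + cell w a b c y 13 + cell w a b c y 14 := by
  rw [measureReal_eq_cellSum w a b c y (show HasPattern (quad a b c y) ((openConn a b ∪ openConn a c) ∩ (openConn a b ∪ openConn y b)) _ from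
    (((((oc a b c y 0 1 rfl rfl)).union (oc a b c y 0 2 rfl rfl))).inter (((oc a b c y 0 1 rfl rfl)).union (oc a b c y 3 1 rfl rfl))))]
  simp (config := {decide := true}) only [ite_true, ite_false]; ring

/-- Dictionary entry: the event `(openConn a b ∪ openConn a y) ∩ (openConn a b ∪ openConn c b)` as a sum of four-point cells. -/
theorem rE5 : (prodBernoulli w).real ((openConn a b ∪ openConn a y) ∩ (openConn a b ∪ openConn c b)) =
    cell w a b c y 6 + cell w a b c y 8 + cell w a b c y 11 + cell w a b c y 12 + cell w a b c y 13 + cell w a b c y 14 := by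
  rw [measureReal_eq_cellSum w a b c y (show HasPattern (quad a b c y) ((openConn a b ∪ openConn a y) ∩ (openConn a b ∪ openConn c b)) _ from
    (((((oc a b c y 0 1 rfl rfl)).union (oc a b c y 0 3 rfl rfl))).inter (((oc a b c y 0 1 rfl rfl)).union (oc a b c y 2 1 rfl rfl))))]
  simp (config := {decide := true}) only [ite_true, ite_false]; ring

/-- Dictionary entry: the event `(openConn a b ∪ openConn a y) ∩ (openConn a b ∪ openConn y b)` as a sum of four-point cells. -/
theorem rE6 : (prodBernoulli w).real ((openConn a b ∪ openConn a y) ∩ (openConn a b ∪ openConn y b)) =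
    cell w a b c y 6 + cell w a b c y 11 + cell w a b c y 12 + cell w a b c y 13 + cell w a b c y 14 := by
  rw [measureReal_eq_cellSum w a b c y (show HasPattern (quad a b c y) ((openConn a b ∪ openConn a y) ∩ (openConn a b ∪ openConn y b)) _ from
    (((((oc a b c y 0 1 rfl rfl)).union (oc a b c y 0 3 rfl rfl))).inter (((oc a b c y 0 1 rfl rfl)).union (oc a b c y 3 1 rfl rfl))))]
  simp (config := {decide := true}) only [ite_true, ite_false]; ring

/-- Dictionary entry: the event `(openConn a b ∪ openConn a c) ∩ (openConn a b ∪ openConn a y) ∩ (openConn a b ∪ openConn c` as a sum of four-point cells. -/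
theorem rE7 : (prodBernoulli w).real ((openConn a b ∪ openConn a c) ∩ (openConn a b ∪ openConn a y) ∩ (openConn a b ∪ openConn c b)) =
    cell w a b c y 6 + cell w a b c y 11 + cell w a b c y 12 + cell w a b c y 13 + cell w a b c y 14 := by
  rw [measureReal_eq_cellSum w a b c y (show HasPattern (quad a b c y) ((openConn a b ∪ openConn a c) ∩ (openConn a b ∪ openConn a y) ∩ (openConn a b ∪ openConn c b)) _ from
    (((((((oc a b c y 0 1 rfl rfl)).union (oc a b c y 0 2 rfl rfl))).inter (((oc a b c y 0 1 rfl rfl)).union (oc a b c y 0 3 rfl rfl)))).inter (((oc a b c y 0 1 rfl rfl)).union (oc a b c y 2 1 rfl rfl))))]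
  simp (config := {decide := true}) only [ite_true, ite_false]; ring

/-- Dictionary entry: the event `(openConn a b ∪ openConn a c) ∩ (openConn a b ∪ openConn a y) ∩ (openConn a b ∪ openConn y` as a sum of four-point cells. -/
theorem rE8 : (prodBernoulli w).real ((openConn a b ∪ openConn a c) ∩ (openConn a b ∪ openConn a y) ∩ (openConn a b ∪ openConn y b)) =
    cell w a b c y 6 + cell w a b c y 11 + cell w a b c y 12 + cell w a b c y 13 + cell w a b c y 14 := by
  rw [measureReal_eq_cellSum w a b c y (show HasPattern (quad a b c y) ((openConn a b ∪ openConn a c) ∩ (openConn a b ∪ openConn a y) ∩ (openConn a b ∪ openConn y b)) _ from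
    (((((((oc a b c y 0 1 rfl rfl)).union (oc a b c y 0 2 rfl rfl))).inter (((oc a b c y 0 1 rfl rfl)).union (oc a b c y 0 3 rfl rfl)))).inter (((oc a b c y 0 1 rfl rfl)).union (oc a b c y 3 1 rfl rfl))))]
  simp (config := {decide := true}) only [ite_true, ite_false]; ring

/-- Dictionary entry: the event `(openConn a b ∪ openConn a c) ∩ (openConn a b ∪ openConn c b) ∩ (openConn a b ∪ openConn y` as a sum of four-point cells. -/
theorem rE9 : (prodBernoulli w).real ((openConn a b ∪ openConn a c) ∩ (openConn a b ∪ openConn c b) ∩ (openConn a b ∪ openConn y b)) =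
    cell w a b c y 6 + cell w a b c y 11 + cell w a b c y 12 + cell w a b c y 13 + cell w a b c y 14 := by
  rw [measureReal_eq_cellSum w a b c y (show HasPattern (quad a b c y) ((openConn a b ∪ openConn a c) ∩ (openConn a b ∪ openConn c b) ∩ (openConn a b ∪ openConn y b)) _ from
    (((((((oc a b c y 0 1 rfl rfl)).union (oc a b c y 0 2 rfl rfl))).inter (((oc a b c y 0 1 rfl rfl)).union (oc a b c y 2 1 rfl rfl)))).inter (((oc a b c y 0 1 rfl rfl)).union (oc a b c y 3 1 rfl rfl))))]
  simp (config := {decide := true}) only [ite_true, ite_false]; ring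

/-- Dictionary entry: the event `(openConn a b ∪ openConn a y) ∩ (openConn a b ∪ openConn c b) ∩ (openConn a b ∪ openConn y` as a sum of four-point cells. -/
theorem rE10 : (prodBernoulli w).real ((openConn a b ∪ openConn a y) ∩ (openConn a b ∪ openConn c b) ∩ (openConn a b ∪ openConn y b)) =
    cell w a b c y 6 + cell w a b c y 11 + cell w a b c y 12 + cell w a b c y 13 + cell w a b c y 14 := by
  rw [measureReal_eq_cellSum w a b c y (show HasPattern (quad a b c y) ((openConn a b ∪ openConn a y) ∩ (openConn a b ∪ openConn c b) ∩ (openConn a b ∪ openConn y b)) _ from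
    (((((((oc a b c y 0 1 rfl rfl)).union (oc a b c y 0 3 rfl rfl))).inter (((oc a b c y 0 1 rfl rfl)).union (oc a b c y 2 1 rfl rfl)))).inter (((oc a b c y 0 1 rfl rfl)).union (oc a b c y 3 1 rfl rfl))))]
  simp (config := {decide := true}) only [ite_true, ite_false]; ring

/-- Dictionary entry: the event `(openConn a b ∪ openConn a c) ∩ (openConn a b ∪ openConn a y) ∩ (openConn a b ∪ openConn c` as a sum of four-point cells. -/
theorem rE11 : (prodBernoulli w).real ((openConn a b ∪ openConn a c) ∩ (openConn a b ∪ openConn a y) ∩ (openConn a b ∪ openConn c b) ∩ (openConn a b ∪ openConn y b)) =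
    cell w a b c y 6 + cell w a b c y 11 + cell w a b c y 12 + cell w a b c y 13 + cell w a b c y 14 := by
  rw [measureReal_eq_cellSum w a b c y (show HasPattern (quad a b c y) ((openConn a b ∪ openConn a c) ∩ (openConn a b ∪ openConn a y) ∩ (openConn a b ∪ openConn c b) ∩ (openConn a b ∪ openConn y b)) _ from
    (((((((((oc a b c y 0 1 rfl rfl)).union (oc a b c y 0 2 rfl rfl))).inter (((oc a b c y 0 1 rfl rfl)).union (oc a b c y 0 3 rfl rfl)))).inter (((oc a b c y 0 1 rfl rfl)).union (oc a b c y 2 1 rfl rfl)))).inter (((oc a b c y 0 1 rfl rfl)).union (oc a b c y 3 1 rfl rfl))))]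
  simp (config := {decide := true}) only [ite_true, ite_false]; ring

/-- **THEOREM (r58inc, every finite weighted graph).**  For Bernoulli bond percolation `prodBernoulli w` with arbitrary edge
weights on a finite vertex type and any vertices `a, b, c, y`:  `0 ≤ E₄(A, B, C, D)` (Sahi's fourth-order functional) for
`A = openConn a b ∪ openConn a c`, `B = openConn a b ∪ openConn a y`, `C = openConn a b ∪ openConn c b`, `D = openConn a b ∪ openConn y b` — a GENERIC (tower-irreducible) increasing quartic
row on four points, proved by prim-masterthm-p1's one-step four-copy switching certificate, spectator-sliced and replayed through the
finite relaxation (`S00 … S14.Sreal_nonpos`) and the reflective quartic identity (`chk_all`, `quartic_sound`). [this work] -/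
theorem sahiE4_nonneg : 0 ≤ sahiE4 (prodBernoulli w) (openConn a b ∪ openConn a c) (openConn a b ∪ openConn a y) (openConn a b ∪ openConn c b) (openConn a b ∪ openConn y b) := by
  have hσ : ∑ i, cell w a b c y i = 1 := by rw [sum_univ_explicit]; exact sum_cell_eq_one w a b c y
  have hP : ∀ i, 0 ≤ cell w a b c y i := fun i => cell_nonneg w a b c y i
  have h := quartic_sound_list certsL S14.cert hT0 hTP hlen chk0 chk_all (cell w a b c y) hσ hP (hES w a b c y)
  simp only [E4cell, E4L, S_cons, S_nil, tyOf_lits, add_zero] at h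
  rw [sahiE4_def, rE11 w a b c y, rE7 w a b c y, rE8 w a b c y, rE9 w a b c y, rE10 w a b c y, rE2 w a b c y, rE3 w a b c y, rE4 w a b c y, rE5 w a b c y, rE6 w a b c y, Summit.CriticalPhenomena.PercolationContinuityZ3.Theorems.SwitchRelax.IncDict.d19 w a b c y, rE0 w a b c y, rE1 w a b c y, Summit.CriticalPhenomena.PercolationContinuityZ3.Theorems.SwitchRelax.IncDict.d17 w a b c y, Summit.CriticalPhenomena.PercolationContinuityZ3.Theorems.SwitchRelax.IncDict.d10 w a b c y]
  linarith [h]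

end Measure

end K4R58

end SwitchRelax

end Summit.CriticalPhenomena.PercolationContinuityZ3.Theorems

end
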